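import Summits.SmoothPoincare4.SmoothPoincare4.Theorems.DottedCircleRasmussenDcrGapHelperFriendsCarrierVkPartAPartIPicture
import Literature.AlgebraicTopology.SingularHomology.ClopenAdditivity

/-!
# Helper `helper_friendsCarrier_Vk_partA_partI` (V_k part A, part I: the tube framing is the Seifert
framing), piece 4: the far/near partition of the collar and of the complement
(line `mk_friends`, crux `DcrGap`; item stmt-SmoothPoincare4-16128, route route-SmoothPoincare4-DottedCircleRasmussen)

For `0 < ε ≤ 1/20` the collar `W = P(M_k ∩ {0 < |w|² < ε})` of the picture and the complement
`O = 𝕊³ ∖ P(M_k ∩ {|w|² ≥ ε})` both split into `k + 1` clopen pieces: the FAR piece (about the axis torus: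
planar reading `|z| > 20(k+1)`, together with the north pole and the axis for `O`) and the NEAR pieces (about
the dotted circles: `|z − c_j| < 27/20`).  The tree's dichotomy `far_or_near_of_le_planarPot` (potential
`≥ 19/20` forces far or near) gives the cover and the gaps; the near pieces of `O` are closed because they are
the traces of the compact revolved discs `{|z − c_j| ≤ 27/20}`, whose boundary tori are pictures of points of
`M_k` with `|w|² > 1/20` (`planarPot_lt_at_edge`).

* `FriendsCarrierVk.partW_isClopenPartition` — the clopen partition of `W` (an `IsClopenPartition` indexed by
  `Fin (k + 1)` through `Fin.cases`);
* `FriendsCarrierVk.partO_isClopen_near`, `partO_isClopen_far` — the clopen pieces of `O`;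
* `helper_friendsCarrier_Vk_partA_partI_partition` — the registered statement.

No definitions, no named facts, no `sorry`.

## References

* R. Kirby, *The Topology of 4-Manifolds*, LNM 1374 (1989), Ch. I §2. [Kirby1989]
* A. Hatcher, *Algebraic Topology*, CUP (2002), Prop. 2.6. [HatcherAT2002]
-/

set_option linter.dupNamespace false
set_option linter.style.longLine false

noncomputable section

open scoped Manifold ContDiff Topology ComplexConjugate
open Function Set Metric TopologicalSpace Literature.Topology.FourManifolds Literature.Topology.FourManifolds.MMSW Literature.AlgebraicTopology.Homotopy.HopfFibration
  Literature.AlgebraicTopology.SingularHomology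

namespace Summit.SmoothPoincare4.SmoothPoincare4.Theorems.DcrGap.MkFriends

namespace FriendsCarrierVk

variable {k : ℕ} {ε : ℝ}

/-! ## Points of the collar -/

/-- A point of the collar `W` is off the north pole, off the axis, reads the planar point of its chart lift,
and lies in `O`. [folklore] -/
theorem partW_point (hε : 0 < ε) {y : sphere (0 : EuclideanSpace ℝ (Fin 4)) 1}
    (hy : y ∈ (fun x : EuclideanSpace ℝ (Fin 4) => stereoNorthInv (draw k x)) '' {x | x ∈ modelBoundary k ∧ wC x ≠ 0 ∧ ‖wC x‖ ^ 2 < ε}) :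
    y ≠ northPole ∧ chartC (stereoNorthCoords (y : EuclideanSpace ℝ (Fin 4))) ≠ 0 ∧
      y ∈ ((fun x : EuclideanSpace ℝ (Fin 4) => stereoNorthInv (draw k x)) '' {x | x ∈ modelBoundary k ∧ ε ≤ ‖wC x‖ ^ 2})ᶜ ∧
      ∃ x, x ∈ modelBoundary k ∧ wC x ≠ 0 ∧ ‖wC x‖ ^ 2 < ε ∧ stereoNorthInv (draw k x) = y ∧
        chartZ k (stereoNorthCoords (y : EuclideanSpace ℝ (Fin 4))) = zC x := by
  obtain ⟨x, ⟨hx, hw, hwε⟩, rfl⟩ := hy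
  have hreg := draw_mem_pictureRegion hx hw
  refine ⟨stereoNorthInv_ne_northPole _, by rw [pic_coords_P]; exact hreg.1, (pic_mem_compl_iff hε hx hw).2 hwε,
    x, hx, hw, hwε, rfl, by rw [pic_coords_P, chartZ_draw hx hw]⟩

/-- The planar reading is continuous on the collar. [folklore] -/
theorem partW_continuous_chartZ (hε : 0 < ε) {W : Set (sphere (0 : EuclideanSpace ℝ (Fin 4)) 1)}
    (hW : W = (fun x : EuclideanSpace ℝ (Fin 4) => stereoNorthInv (draw k x)) '' {x | x ∈ modelBoundary k ∧ wC x ≠ 0 ∧ ‖wC x‖ ^ 2 < ε}) :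
    Continuous fun y : ↥W => chartZ k (stereoNorthCoords ((y : sphere (0 : EuclideanSpace ℝ (Fin 4)) 1) : EuclideanSpace ℝ (Fin 4))) := by
  have hZ : Continuous (chartZ k) := by unfold chartZ chartC; fun_prop
  refine hZ.comp (pic_continuousOn_coords.comp_continuous continuous_subtype_val fun y => ?_)
  exact (partW_point hε (by rw [← hW]; exact y.2)).1

/-- **The far/near partition of the collar `W` is a clopen partition** indexed by `Fin (k + 1)`
(`0`: far, `j + 1`: near the hole `j`). [cite: HatcherAT2002, Prop. 2.6] -/
theorem partW_isClopenPartition (hε : 0 < ε) (hε' : ε ≤ 1 / 20) {W : Set (sphere (0 : EuclideanSpace ℝ (Fin 4)) 1)}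
    (hW : W = (fun x : EuclideanSpace ℝ (Fin 4) => stereoNorthInv (draw k x)) '' {x | x ∈ modelBoundary k ∧ wC x ≠ 0 ∧ ‖wC x‖ ^ 2 < ε}) :
    IsClopenPartition (fun i : Fin (k + 1) => Fin.cases
      {y : ↥W | 20 * ((k : ℝ) + 1) < ‖chartZ k (stereoNorthCoords ((y : sphere (0 : EuclideanSpace ℝ (Fin 4)) 1) : EuclideanSpace ℝ (Fin 4)))‖}
      (fun j => {y : ↥W | ‖chartZ k (stereoNorthCoords ((y : sphere (0 : EuclideanSpace ℝ (Fin 4)) 1) : EuclideanSpace ℝ (Fin 4))) - holeCentre k j‖ < 27 / 20}) i) := by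
  have hc := partW_continuous_chartZ hε hW
  refine ⟨fun i => ?_, fun i i' hii' => ?_, fun y => ?_⟩
  · refine Fin.cases ?_ (fun j => ?_) i
    · simp only [Fin.cases_zero]
      exact isOpen_lt continuous_const hc.norm
    · simp only [Fin.cases_succ]
      exact isOpen_lt ((hc.sub continuous_const).norm) continuous_const
  · refine Set.disjoint_left.2 fun y hy hy' => hii' ?_
    revert hy hy'
    refine Fin.cases ?_ (fun j => ?_) i <;> refine Fin.cases ?_ (fun j' => ?_) i' <;>
      simp only [Fin.cases_zero, Fin.cases_succ, mem_setOf_eq] <;> intro hy hy'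
    · trivial
    · linarith [(pic_near_bounds hy').1]
    · linarith [(pic_near_bounds hy).1]
    · by_contra hne
      have hjj : j' ≠ j := fun h => hne (by rw [h])
      linarith [(pic_near_bounds hy).2 j' hjj]
  · obtain ⟨hN, hC, hO, -⟩ := partW_point hε (by rw [← hW]; exact y.2)
    rcases pic_far_or_near_of_mem_compl hε hε' hO hN hC with hfar | ⟨j, hj⟩
    · exact ⟨0, by simpa using hfar⟩
    · exact ⟨j.succ, by simpa using hj⟩

/-- The far piece of the collar is the trace of the picture of the far punctured tube. [folklore] -/
theorem partW_far_eq (hε : 0 < ε) {W : Set (sphere (0 : EuclideanSpace ℝ (Fin 4)) 1)}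
    (hW : W = (fun x : EuclideanSpace ℝ (Fin 4) => stereoNorthInv (draw k x)) '' {x | x ∈ modelBoundary k ∧ wC x ≠ 0 ∧ ‖wC x‖ ^ 2 < ε}) :
    {y : ↥W | 20 * ((k : ℝ) + 1) < ‖chartZ k (stereoNorthCoords ((y : sphere (0 : EuclideanSpace ℝ (Fin 4)) 1) : EuclideanSpace ℝ (Fin 4)))‖} =
      Subtype.val ⁻¹' ((fun x : EuclideanSpace ℝ (Fin 4) => stereoNorthInv (draw k x)) ''
        {x | x ∈ modelBoundary k ∧ wC x ≠ 0 ∧ ‖wC x‖ ^ 2 < ε ∧ 20 * ((k : ℝ) + 1) < ‖zC x‖}) := by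
  ext y
  obtain ⟨-, -, -, x, hx, hw, hwε, hP, hz⟩ := partW_point hε (by rw [← hW]; exact y.2)
  simp only [mem_setOf_eq, mem_preimage]
  constructor
  · intro hfar
    exact ⟨x, ⟨hx, hw, hwε, by rw [← hz]; exact hfar⟩, hP⟩
  · rintro ⟨x', ⟨hx', hw', -, hfar⟩, hP'⟩
    have := pic_injOn ⟨hx', hw'⟩ ⟨hx, hw⟩ (hP'.trans hP.symm)
    subst this
    rw [hz]; exact hfar

/-- The near pieces of the collar are the traces of the pictures of the near punctured tubes. [folklore] -/
theorem partW_near_eq (hε : 0 < ε) {W : Set (sphere (0 : EuclideanSpace ℝ (Fin 4)) 1)}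
    (hW : W = (fun x : EuclideanSpace ℝ (Fin 4) => stereoNorthInv (draw k x)) '' {x | x ∈ modelBoundary k ∧ wC x ≠ 0 ∧ ‖wC x‖ ^ 2 < ε}) (j : Fin k) :
    {y : ↥W | ‖chartZ k (stereoNorthCoords ((y : sphere (0 : EuclideanSpace ℝ (Fin 4)) 1) : EuclideanSpace ℝ (Fin 4))) - holeCentre k j‖ < 27 / 20} =
      Subtype.val ⁻¹' ((fun x : EuclideanSpace ℝ (Fin 4) => stereoNorthInv (draw k x)) ''
        {x | x ∈ modelBoundary k ∧ wC x ≠ 0 ∧ ‖wC x‖ ^ 2 < ε ∧ ‖zC x - holeCentre k j‖ < 27 / 20}) := by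
  ext y
  obtain ⟨-, -, -, x, hx, hw, hwε, hP, hz⟩ := partW_point hε (by rw [← hW]; exact y.2)
  simp only [mem_setOf_eq, mem_preimage]
  constructor
  · intro hnear
    exact ⟨x, ⟨hx, hw, hwε, by rw [← hz]; exact hnear⟩, hP⟩
  · rintro ⟨x', ⟨hx', hw', -, hnear⟩, hP'⟩
    have := pic_injOn ⟨hx', hw'⟩ ⟨hx, hw⟩ (hP'.trans hP.symm)
    subst this
    rw [hz]; exact hnear

/-! ## The clopen pieces of the complement `O` -/

/-- The chart readings are continuous on `{y ≠ N}`: `chartZ` and `chartC` of the coordinates. [folklore] -/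
theorem partO_continuousOn_readings :
    ContinuousOn (fun y : sphere (0 : EuclideanSpace ℝ (Fin 4)) 1 =>
      (chartZ k (stereoNorthCoords (y : EuclideanSpace ℝ (Fin 4))), chartC (stereoNorthCoords (y : EuclideanSpace ℝ (Fin 4)))))
      {y | y ≠ northPole} := by
  have hZ : Continuous (chartZ k) := by unfold chartZ chartC; fun_prop
  have hC : Continuous chartC := by unfold chartC; fun_prop
  exact (hZ.prodMk hC).comp_continuousOn pic_continuousOn_coords

/-- **The near piece of `O` about the hole `j` is open** in `O`. [folklore] -/
theorem partO_isOpen_near (O : Set (sphere (0 : EuclideanSpace ℝ (Fin 4)) 1)) (j : Fin k) :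
    IsOpen {y : ↥O | (y : sphere (0 : EuclideanSpace ℝ (Fin 4)) 1) ≠ northPole ∧
      chartC (stereoNorthCoords ((y : sphere (0 : EuclideanSpace ℝ (Fin 4)) 1) : EuclideanSpace ℝ (Fin 4))) ≠ 0 ∧
      ‖chartZ k (stereoNorthCoords ((y : sphere (0 : EuclideanSpace ℝ (Fin 4)) 1) : EuclideanSpace ℝ (Fin 4))) - holeCentre k j‖ < 27 / 20} := by
  have h1 : IsOpen {y : sphere (0 : EuclideanSpace ℝ (Fin 4)) 1 | y ≠ northPole ∧
      chartC (stereoNorthCoords (y : EuclideanSpace ℝ (Fin 4))) ≠ 0 ∧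
      ‖chartZ k (stereoNorthCoords (y : EuclideanSpace ℝ (Fin 4))) - holeCentre k j‖ < 27 / 20} := by
    have hU : IsOpen {q : ℂ × ℂ | q.2 ≠ 0 ∧ ‖q.1 - holeCentre k j‖ < 27 / 20} :=
      (isOpen_ne_fun continuous_snd continuous_const).inter
        (isOpen_lt ((continuous_fst.sub continuous_const).norm) continuous_const)
    have := (partO_continuousOn_readings (k := k)).isOpen_inter_preimage (isOpen_ne_fun continuous_id continuous_const) hU
    convert this using 1
    ext y; simp only [mem_setOf_eq, mem_inter_iff, mem_preimage]
  exact h1.preimage continuous_subtype_val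

/-- **The near piece of `O` about the hole `j` is closed** in `O` (`0 < ε ≤ 1/20`): it is the trace of the
compact revolved closed disc `{|z − c_j| ≤ 27/20}`, whose boundary torus consists of pictures of points of
`M_k` with `|w|² > 1/20 ≥ ε`. [folklore] -/
theorem partO_isClosed_near (hε : 0 < ε) (hε' : ε ≤ 1 / 20) {O : Set (sphere (0 : EuclideanSpace ℝ (Fin 4)) 1)}
    (hO : O = ((fun x : EuclideanSpace ℝ (Fin 4) => stereoNorthInv (draw k x)) '' {x | x ∈ modelBoundary k ∧ ε ≤ ‖wC x‖ ^ 2})ᶜ) (j : Fin k) :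
    IsClosed {y : ↥O | (y : sphere (0 : EuclideanSpace ℝ (Fin 4)) 1) ≠ northPole ∧
      chartC (stereoNorthCoords ((y : sphere (0 : EuclideanSpace ℝ (Fin 4)) 1) : EuclideanSpace ℝ (Fin 4))) ≠ 0 ∧
      ‖chartZ k (stereoNorthCoords ((y : sphere (0 : EuclideanSpace ℝ (Fin 4)) 1) : EuclideanSpace ℝ (Fin 4))) - holeCentre k j‖ < 27 / 20} := by
  have hk : (0 : ℝ) ≤ k := Nat.cast_nonneg k
  -- the compact revolved closed disc
  set K : Set (sphere (0 : EuclideanSpace ℝ (Fin 4)) 1) := (fun q : ℂ × ℂ => stereoNorthInv (cpt k q.1 q.2)) ''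
    (closedBall (holeCentre k j) (27 / 20) ×ˢ sphere (0 : ℂ) 1) with hK
  have hKc : IsCompact K := ((isCompact_closedBall _ _).prod (isCompact_sphere _ _)).image
    (continuous_stereoNorthInv.comp (contDiff_cpt k).continuous)
  suffices heq : {y : ↥O | (y : sphere (0 : EuclideanSpace ℝ (Fin 4)) 1) ≠ northPole ∧
      chartC (stereoNorthCoords ((y : sphere (0 : EuclideanSpace ℝ (Fin 4)) 1) : EuclideanSpace ℝ (Fin 4))) ≠ 0 ∧
      ‖chartZ k (stereoNorthCoords ((y : sphere (0 : EuclideanSpace ℝ (Fin 4)) 1) : EuclideanSpace ℝ (Fin 4))) - holeCentre k j‖ < 27 / 20} =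
      Subtype.val ⁻¹' K by
    rw [heq]; exact hKc.isClosed.preimage continuous_subtype_val
  ext y
  simp only [mem_setOf_eq, mem_preimage]
  constructor
  · rintro ⟨hN, hC, hnear⟩
    refine ⟨(chartZ k (stereoNorthCoords ((y : sphere (0 : EuclideanSpace ℝ (Fin 4)) 1) : EuclideanSpace ℝ (Fin 4))),
      dirC (stereoNorthCoords ((y : sphere (0 : EuclideanSpace ℝ (Fin 4)) 1) : EuclideanSpace ℝ (Fin 4)))), ⟨?_, ?_⟩, ?_⟩
    · exact mem_closedBall.2 (by rw [dist_eq_norm]; exact hnear.le)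
    · exact mem_sphere_zero_iff_norm.2 (norm_dirC hC)
    · exact (pic_eq_stereoNorthInv_cpt hN).symm
  · rintro ⟨⟨z, u⟩, ⟨hz, hu⟩, hyq⟩
    rw [mem_closedBall, dist_eq_norm] at hz
    rw [mem_sphere_zero_iff_norm] at hu
    simp only at hyq
    have hzn : ‖z‖ ≤ 4 * k + 27 / 20 := by
      have := norm_le_norm_sub_add z (holeCentre k j)
      linarith [norm_holeCentre_le (r := k) j]
    have hre : 0 < z.re + drawRadius k := by
      have := Complex.abs_re_le_norm z; have := neg_abs_le z.re
      unfold drawRadius; linarith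
    have hN : (y : sphere (0 : EuclideanSpace ℝ (Fin 4)) 1) ≠ northPole := by rw [← hyq]; exact stereoNorthInv_ne_northPole _
    have hcoords : stereoNorthCoords ((y : sphere (0 : EuclideanSpace ℝ (Fin 4)) 1) : EuclideanSpace ℝ (Fin 4)) = cpt k z u := by
      rw [← hyq, coe_stereoNorthInv, stereoNorthCoords_stereoNorthInvCoe]
    have hC : chartC (cpt k z u) ≠ 0 := by
      rw [chartC_cpt]; exact mul_ne_zero (by exact_mod_cast hre.ne') (by rw [← norm_ne_zero_iff, hu]; exact one_ne_zero)
    have hZ : chartZ k (cpt k z u) = z := chartZ_cpt hu hre.le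
    refine ⟨hN, by rw [hcoords]; exact hC, ?_⟩
    rw [hcoords, hZ]
    rcases hz.lt_or_eq with hlt | heq
    · exact hlt
    · -- on the boundary torus the point is the picture of a point of `M_k` with `|w|² > 1/20`
      exfalso
      have hy : (y : sphere (0 : EuclideanSpace ℝ (Fin 4)) 1) ∈ ((fun x : EuclideanSpace ℝ (Fin 4) => stereoNorthInv (draw k x)) ''
          {x | x ∈ modelBoundary k ∧ ε ≤ ‖wC x‖ ^ 2})ᶜ := by rw [← hO]; exact y.2
      rcases pic_mem_compl_imp hε hy hN (by rw [hcoords]; exact hC) with ⟨i, hi⟩ | hpot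
      · rw [hcoords, hZ, Complex.normSq_eq_norm_sq] at hi
        by_cases hij : i = j
        · subst hij; nlinarith
        · have := norm_sub_holeCentre_ge_of_near hz hij
          nlinarith
      · rw [hcoords, hZ] at hpot
        have hzeq : z = holeCentre k j + (((27 : ℝ) / 20 : ℝ) : ℂ) * unitDir (holeCentre k j) z := by
          conv_lhs => rw [eq_centre_add_norm_mul_unitDir (holeCentre k j) z, heq]
        have hzj : z ≠ holeCentre k j := by intro h; rw [h, sub_self, norm_zero] at heq; norm_num at heq
        have := planarPot_lt_at_edge j (norm_unitDir hzj) (k := k)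
        rw [← hzeq] at this
        linarith

/-- **The far piece of `O` is the complement of the near pieces** (`0 < ε ≤ 1/20`). [folklore] -/
theorem partO_far_eq (hε : 0 < ε) (hε' : ε ≤ 1 / 20) {O : Set (sphere (0 : EuclideanSpace ℝ (Fin 4)) 1)}
    (hO : O = ((fun x : EuclideanSpace ℝ (Fin 4) => stereoNorthInv (draw k x)) '' {x | x ∈ modelBoundary k ∧ ε ≤ ‖wC x‖ ^ 2})ᶜ) :
    {y : ↥O | (y : sphere (0 : EuclideanSpace ℝ (Fin 4)) 1) = northPole ∨
      chartC (stereoNorthCoords ((y : sphere (0 : EuclideanSpace ℝ (Fin 4)) 1) : EuclideanSpace ℝ (Fin 4))) = 0 ∨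
      20 * ((k : ℝ) + 1) < ‖chartZ k (stereoNorthCoords ((y : sphere (0 : EuclideanSpace ℝ (Fin 4)) 1) : EuclideanSpace ℝ (Fin 4)))‖} =
    (⋃ j : Fin k, {y : ↥O | (y : sphere (0 : EuclideanSpace ℝ (Fin 4)) 1) ≠ northPole ∧
      chartC (stereoNorthCoords ((y : sphere (0 : EuclideanSpace ℝ (Fin 4)) 1) : EuclideanSpace ℝ (Fin 4))) ≠ 0 ∧
      ‖chartZ k (stereoNorthCoords ((y : sphere (0 : EuclideanSpace ℝ (Fin 4)) 1) : EuclideanSpace ℝ (Fin 4))) - holeCentre k j‖ < 27 / 20})ᶜ := by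
  ext y
  simp only [mem_setOf_eq, mem_compl_iff, mem_iUnion, not_exists, not_and, not_lt]
  constructor
  · rintro (hN | hC | hfar) j hN' hC'
    · exact absurd hN hN'
    · exact absurd hC hC'
    · by_contra hlt; push Not at hlt
      linarith [(pic_near_bounds hlt).1]
  · intro h
    by_cases hN : (y : sphere (0 : EuclideanSpace ℝ (Fin 4)) 1) = northPole
    · exact Or.inl hN
    by_cases hC : chartC (stereoNorthCoords ((y : sphere (0 : EuclideanSpace ℝ (Fin 4)) 1) : EuclideanSpace ℝ (Fin 4))) = 0
    · exact Or.inr (Or.inl hC)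
    have hy : (y : sphere (0 : EuclideanSpace ℝ (Fin 4)) 1) ∈ ((fun x : EuclideanSpace ℝ (Fin 4) => stereoNorthInv (draw k x)) ''
        {x | x ∈ modelBoundary k ∧ ε ≤ ‖wC x‖ ^ 2})ᶜ := by rw [← hO]; exact y.2
    rcases pic_far_or_near_of_mem_compl hε hε' hy hN hC with hfar | ⟨j, hj⟩
    · exact Or.inr (Or.inr hfar)
    · exact absurd (h j hN hC) (not_le.2 hj)

/-- **The near pieces of `O` are clopen.** [folklore] -/
theorem partO_isClopen_near (hε : 0 < ε) (hε' : ε ≤ 1 / 20) {O : Set (sphere (0 : EuclideanSpace ℝ (Fin 4)) 1)}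
    (hO : O = ((fun x : EuclideanSpace ℝ (Fin 4) => stereoNorthInv (draw k x)) '' {x | x ∈ modelBoundary k ∧ ε ≤ ‖wC x‖ ^ 2})ᶜ) (j : Fin k) :
    IsClopen {y : ↥O | (y : sphere (0 : EuclideanSpace ℝ (Fin 4)) 1) ≠ northPole ∧
      chartC (stereoNorthCoords ((y : sphere (0 : EuclideanSpace ℝ (Fin 4)) 1) : EuclideanSpace ℝ (Fin 4))) ≠ 0 ∧
      ‖chartZ k (stereoNorthCoords ((y : sphere (0 : EuclideanSpace ℝ (Fin 4)) 1) : EuclideanSpace ℝ (Fin 4))) - holeCentre k j‖ < 27 / 20} :=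
  ⟨partO_isClosed_near hε hε' hO j, partO_isOpen_near O j⟩

/-- **The far piece of `O` is clopen.** [folklore] -/
theorem partO_isClopen_far (hε : 0 < ε) (hε' : ε ≤ 1 / 20) {O : Set (sphere (0 : EuclideanSpace ℝ (Fin 4)) 1)}
    (hO : O = ((fun x : EuclideanSpace ℝ (Fin 4) => stereoNorthInv (draw k x)) '' {x | x ∈ modelBoundary k ∧ ε ≤ ‖wC x‖ ^ 2})ᶜ) :
    IsClopen {y : ↥O | (y : sphere (0 : EuclideanSpace ℝ (Fin 4)) 1) = northPole ∨
      chartC (stereoNorthCoords ((y : sphere (0 : EuclideanSpace ℝ (Fin 4)) 1) : EuclideanSpace ℝ (Fin 4))) = 0 ∨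
      20 * ((k : ℝ) + 1) < ‖chartZ k (stereoNorthCoords ((y : sphere (0 : EuclideanSpace ℝ (Fin 4)) 1) : EuclideanSpace ℝ (Fin 4)))‖} := by
  rw [partO_far_eq hε hε' hO]
  exact (isClopen_iUnion_of_finite fun j => partO_isClopen_near hε hε' hO j).compl

end FriendsCarrierVk

open FriendsCarrierVk in
/-- **Piece 4 of part I of V_k part A: the far/near partitions.**  For `0 < ε ≤ 1/20`, the collar
`W = P(M_k ∩ {0 < |w|² < ε})` is the clopen disjoint union of its far piece and its near pieces (an
`IsClopenPartition` indexed by `Fin (k + 1)`), these pieces are the traces of the pictures of the far and near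
punctured tubes, and the far piece and the near pieces of `O = 𝕊³ ∖ P(M_k ∩ {|w|² ≥ ε})` are clopen in `O`.
[cite: HatcherAT2002, Prop. 2.6] -/
theorem helper_friendsCarrier_Vk_partA_partI_partition : ∀ (k : ℕ) (ε : ℝ), 0 < ε → ε ≤ 1 / 20 → ∀ (W O : Set (sphere (0 : EuclideanSpace ℝ (Fin 4)) 1)), W = (fun x : EuclideanSpace ℝ (Fin 4) => stereoNorthInv (draw k x)) '' {x | x ∈ modelBoundary k ∧ wC x ≠ 0 ∧ ‖wC x‖ ^ 2 < ε} → O = ((fun x : EuclideanSpace ℝ (Fin 4) => stereoNorthInv (draw k x)) '' {x | x ∈ modelBoundary k ∧ ε ≤ ‖wC x‖ ^ 2})ᶜ → IsClopenPartition (fun i : Fin (k + 1) => Fin.cases {y : ↥W | 20 * ((k : ℝ) + 1) < ‖chartZ k (stereoNorthCoords ((y : sphere (0 : EuclideanSpace ℝ (Fin 4)) 1) : EuclideanSpace ℝ (Fin 4)))‖} (fun j => {y : ↥W | ‖chartZ k (stereoNorthCoords ((y : sphere (0 : EuclideanSpace ℝ (Fin 4)) 1) : EuclideanSpace ℝ (Fin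 4))) - holeCentre k j‖ < 27 / 20}) i) ∧ {y : ↥W | 20 * ((k : ℝ) + 1) < ‖chartZ k (stereoNorthCoords ((y : sphere (0 : EuclideanSpace ℝ (Fin 4)) 1) : EuclideanSpace ℝ (Fin 4)))‖} = Subtype.val ⁻¹' ((fun x : EuclideanSpace ℝ (Fin 4) => stereoNorthInv (draw k x)) '' {x | x ∈ modelBoundary k ∧ wC x ≠ 0 ∧ ‖wC x‖ ^ 2 < ε ∧ 20 * ((k : ℝ) + 1) < ‖zC x‖}) ∧ (∀ j : Fin k, {y : ↥W | ‖chartZ k (stereoNorthCoords ((y : sphere (0 : EuclideanSpace ℝ (Fin 4)) 1) : EuclideanSpace ℝ (Fin 4))) - holeCentre k j‖ < 27 / 20} = Subtype.val ⁻¹' ((fun x : EuclideanSpace ℝ (Fin 4) => stereoNorthInv (draw k x)) '' {x | x ∈ modelBoundary k ∧ wC x ≠ 0 ∧ ‖wC x‖ ^ 2 < ε ∧ ‖zC x - holeCentre k j‖ < 27 / 20})) ∧ IsClopen {y : ↥O | (y : sphere (0 : EuclideanSpace ℝ (Fin 4)) 1) = northPole ∨ chartC (stereoNorthCoords ((y :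 sphere (0 : EuclideanSpace ℝ (Fin 4)) 1) : EuclideanSpace ℝ (Fin 4))) = 0 ∨ 20 * ((k : ℝ) + 1) < ‖chartZ k (stereoNorthCoords ((y : sphere (0 : EuclideanSpace ℝ (Fin 4)) 1) : EuclideanSpace ℝ (Fin 4)))‖} ∧ ∀ j : Fin k, IsClopen {y : ↥O | (y : sphere (0 : EuclideanSpace ℝ (Fin 4)) 1) ≠ northPole ∧ chartC (stereoNorthCoords ((y : sphere (0 : EuclideanSpace ℝ (Fin 4)) 1) : EuclideanSpace ℝ (Fin 4))) ≠ 0 ∧ ‖chartZ k (stereoNorthCoords ((y : sphere (0 : EuclideanSpace ℝ (Fin 4)) 1) : EuclideanSpace ℝ (Fin 4))) - holeCentre k j‖ < 27 / 20} :=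
  fun _ _ hε hε' _ _ hW hO => ⟨partW_isClopenPartition hε hε' hW, partW_far_eq hε hW, partW_near_eq hε hW,
    partO_isClopen_far hε hε' hO, partO_isClopen_near hε hε' hO⟩

end Summit.SmoothPoincare4.SmoothPoincare4.Theorems.DcrGap.MkFriends
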